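import Summits.PneNP.PneNP.Theses.ForcedSplits
import Literature.Computability.Complexity.ClayProblemProofs
import Literature.Computability.Complexity.NegCNFTranscoder

/-!
# Route ForcedSplits — `Assembly` (stmt-PneNP-10471)

`FlowDefectFloor → PneNP`. By contradiction: `¬ PneNP` puts every `PNPWave0.NP Bool` language into
`PNPWave0.P Bool`; `SAT ∈ Nondeterministic.NP = PNPWave0.NP Bool` (`SAT_mem_NP_holds`, `NP_bool_eq_holds`) yields a
polynomial-time predicate `f` with `f w = true ↔ w ∈ SAT`, hence `f (code φ) = true ↔ φ.Satisfiable` (`mem_SAT_iff`).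
Feed `f` to thesis X: its wrapped labelling `g ψ = f (code ψ) && [[] ∉ ψ]` is the indicator of satisfiability, and
the restriction lemma `ψ` satisfiable `↔` some branch `ψ[v := b]` satisfiable (`satisfiable_restrict_iff`) shows that
no step of any path violates `g ψ = g ψ[v:=0] ∨ g ψ[v:=1]`; so the violation count is identically `0`, the
expectation is `0`, and `(n⁻¹)^C ≤ 0` fails for every `n` — contradicting `∃ᶠ n`.
-/

set_option linter.dupNamespace false -- `Summit.PneNP.PneNP.…`: summit = sub-problem name (D-0017 single-conjunct layout)

namespace Summit.PneNP.PneNP.Theorems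

open _root_.Computability
open Literature.Computability.Complexity

/-- **Restriction lemma** for the route's inline `restrict ψ v b` (drop the clauses containing the literal `(v, b)`,
delete the literal `(v, ¬b)` from the rest): `ψ[v := b]` is satisfiable iff `ψ` has a model with `σ v = b`.
[cite: AroraBarak2009, §2.3] [folklore] -/
theorem forcedSplits_satisfiable_restrict_iff (ψ : CNF ℕ) (v : ℕ) (b : Bool) :
    CNF.Satisfiable ((ψ.filter fun c => decide ((v, b) ∉ c)).map fun c => c.filter fun l => decide (l ≠ (v, !b))) ↔
      ∃ σ : ℕ → Bool, ψ.eval σ = true ∧ σ v = b := by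
  constructor
  · rintro ⟨σ', hσ'⟩
    refine ⟨Function.update σ' v b, ?_, Function.update_self ..⟩
    rw [CNF.eval_eq_true_iff] at hσ' ⊢
    intro c hc
    by_cases hvc : (v, b) ∈ c
    · simp only [Clause.eval, List.any_eq_true]
      exact ⟨(v, b), hvc, by simp [Literal.eval]⟩
    · have hc' : (c.filter fun l => decide (l ≠ (v, !b))) ∈
          ((ψ.filter fun c => decide ((v, b) ∉ c)).map fun c => c.filter fun l => decide (l ≠ (v, !b))) :=
        List.mem_map.2 ⟨c, List.mem_filter.2 ⟨hc, by simpa using hvc⟩, rfl⟩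
      have h := hσ' _ hc'
      simp only [Clause.eval, List.any_eq_true, List.mem_filter, decide_eq_true_eq] at h ⊢
      obtain ⟨l, ⟨hl, hne⟩, hev⟩ := h
      refine ⟨l, hl, ?_⟩
      rcases l with ⟨u, b'⟩
      by_cases hu : u = v
      · subst hu
        have hb' : b' = b := by
          cases b <;> cases b' <;> simp_all
        subst hb'
        exact absurd hl hvc
      · simpa [Literal.eval, Function.update_of_ne hu] using hev
  · rintro ⟨σ, hσ, hv⟩
    refine ⟨σ, ?_⟩
    rw [CNF.eval_eq_true_iff] at hσ ⊢
    intro c' hc'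
    obtain ⟨c, hc, rfl⟩ := List.mem_map.1 hc'
    obtain ⟨hcψ, -⟩ := List.mem_filter.1 hc
    have h := hσ c hcψ
    simp only [Clause.eval, List.any_eq_true, List.mem_filter, decide_eq_true_eq] at h ⊢
    obtain ⟨l, hl, hev⟩ := h
    refine ⟨l, ⟨hl, ?_⟩, hev⟩
    rintro rfl
    simp [Literal.eval, hv] at hev

/-- A CNF is satisfiable iff one of its two restrictions at a variable `v` is. [cite: AroraBarak2009, §2.3] [folklore] -/
theorem forcedSplits_satisfiable_iff_restrict (ψ : CNF ℕ) (v : ℕ) :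
    ψ.Satisfiable ↔
      CNF.Satisfiable ((ψ.filter fun c => decide ((v, false) ∉ c)).map fun c => c.filter fun l => decide (l ≠ (v, !false))) ∨
      CNF.Satisfiable ((ψ.filter fun c => decide ((v, true) ∉ c)).map fun c => c.filter fun l => decide (l ≠ (v, !true))) := by
  rw [forcedSplits_satisfiable_restrict_iff, forcedSplits_satisfiable_restrict_iff]
  constructor
  · rintro ⟨σ, hσ⟩
    cases h : σ v
    · exact Or.inl ⟨σ, hσ, h⟩
    · exact Or.inr ⟨σ, hσ, h⟩
  · rintro (⟨σ, hσ, -⟩ | ⟨σ, hσ, -⟩) <;> exact ⟨σ, hσ⟩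

/-- **Assembly of route ForcedSplits (stmt-PneNP-10471)**: `FlowDefectFloor → PneNP`. The SAT-decider `f` that
`¬ PneNP` provides (through `SAT_mem_NP_holds` and the proved bridge `NP_bool_eq_holds`) has violation count
identically zero (restriction lemma), so the flow-defect floor `(n⁻¹)^C ≤ 𝔼[violations] = 0` fails at every `n`.
[cite: Cook1971, Thm 1] [cite: AroraBarak2009, §2.3] -/
theorem forcedSplits_assembly_proof : Summit.PneNP.PneNP.Theses.ForcedSplits.Assembly := by
  intro hX
  by_contra hne
  -- `¬ PneNP`: every Wave0-NP language is Wave0-P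
  have hall : ∀ L : Language Bool, L ∈ PNPWave0.NP Bool → L ∈ PNPWave0.P Bool := by
    intro L hL
    by_contra hLP
    exact hne ⟨L, hL, hLP⟩
  have hSAT : SAT ∈ PNPWave0.P Bool := by
    refine hall SAT ?_
    rw [show PNPWave0.NP Bool = Nondeterministic.NP from NP_bool_eq_holds]
    exact SAT_mem_NP_holds
  obtain ⟨f, hf, hmem⟩ := hSAT
  have hfφ : ∀ φ : CNF ℕ, f (encodingCNF.encode φ) = true ↔ φ.Satisfiable := fun φ =>
    (hmem _).symm.trans (mem_SAT_iff φ)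
  -- the wrapped labelling is the indicator of satisfiability (any `Decidable` instance)
  have hg : ∀ (ψ : CNF ℕ) (d : Decidable (([] : Clause ℕ) ∉ ψ)),
      (f (encodingCNF.encode ψ) && @decide _ d) = true ↔ ψ.Satisfiable := by
    intro ψ d
    rw [Bool.and_eq_true, hfφ, decide_eq_true_iff]
    exact ⟨fun h => h.1, fun h => ⟨h, fun h0 => CNF.not_satisfiable_of_nil_mem h0 h⟩⟩
  obtain ⟨C, hC⟩ := hX f hf fun φ hφ => (hfφ φ).2 hφ
  obtain ⟨n, hn⟩ := hC.exists
  revert hn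
  rw [imp_false, not_le]
  beta_reduce
  rw [ENNReal.tsum_eq_zero.2]
  · exact pos_iff_ne_zero.2 (pow_ne_zero _ (ENNReal.inv_ne_zero.2 (ENNReal.natCast_ne_top n)))
  · intro ω
    rw [mul_eq_zero]
    right
    rw [Nat.cast_eq_zero, List.countP_eq_zero]
    intro r _
    rw [Bool.not_eq_true, bne_eq_false_iff_eq, Bool.eq_iff_iff, Bool.or_eq_true, hg, hg, hg]
    exact forcedSplits_satisfiable_iff_restrict r.1 r.2.1

end Summit.PneNP.PneNP.Theorems
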